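import Summits.BirchSwinnertonDyer.BirchSwinnertonDyer.Theorems.Rank2ObservatoryRank3PSatS10CpsCensusC
import Summits.BirchSwinnertonDyer.BirchSwinnertonDyer.Theorems.Rank2ObservatoryRank3PSatS10CpsCensusD
import Summits.BirchSwinnertonDyer.BirchSwinnertonDyer.Theorems.Rank2ObservatoryRank3PSatS10CpsCensusE
import Summits.BirchSwinnertonDyer.BirchSwinnertonDyer.Theorems.Rank2ObservatoryRank3GeneratorsCensusD
import Summits.BirchSwinnertonDyer.BirchSwinnertonDyer.Theorems.Rank2ObservatoryRank3GeneratorsCensusE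
import Summits.BirchSwinnertonDyer.BirchSwinnertonDyer.Theorems.Rank2ObservatoryRank3GeneratorsCensusF
import HarnessLib

/-!
# BirchSwinnertonDyer — rank ≥ 2 observatory: GENERATORS CENSUS of record — TAIL SUPPLEMENT (S10-CPS), chunks 15–27

HONEST FRAMING: per-curve certified theorems and census instruments; no claim on BSD in rank ≥ 2.

THE TAIL SUPPLEMENT of the generators census of record (`GeneratorsCensus.generatorsNN` /
`censusNN`, files `…GeneratorsCensusA–F`: 9091 of the 9487 rank-3 table rows, residual 396 = exactly
the rows with register-J11 bound `> 100`) by the LANDED S10-CPS census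
(`PSatCensusS10CPS.generatorsNN`, files `…PSatS10CpsCensusA–E`, register J11c: the residual rows
with the two-implementation Cremona–Prickett–Siksek-bound search datum `m ≤ 10` — Hermite, or `m =
1` by saturation-by-exhaustive-search — joined with KS3 exactly like the S10 census; EMPTY
certificate lists, nothing beyond `p ≤ 7`). Per chunk NN ONE theorem `censusTNN` lets the KERNEL
recompute the census from the statements of `GeneratorsCensus.generatorsNN` (list `U`) and of the
chunk's S10-CPS generator theorem (list `V`), both entering by unification — nothing restated, no
definitions, no new certificates, no data as hypotheses, no `native_decide`: the lengths of `U` and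
`V`, the number of rows of the chunk, and the exact positions still uncovered (labels in the
docstring, if any). Whole table: 9091 + 396 = 9487 of 9487 rows covered, residual 0
(`census_total_tail`).

References: Cremona–Prickett–Siksek, J. Number Theory 116 (2006) 42–68 [CremonaPrickettSiksek2006];
Siksek, Rocky Mountain J. Math. 25 (1995) §3; Cremona, *Algorithms for Modular Elliptic Curves*
(1997) §3.5 and Tables; Silverman, *The Arithmetic of Elliptic Curves* (2009) VIII.6.7.
-/

-- single-conjunct summit: `Summit.BirchSwinnertonDyer.BirchSwinnertonDyer.…` repeats the name
set_option linter.dupNamespace false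

namespace Summit.BirchSwinnertonDyer.BirchSwinnertonDyer.Rank2Observatory

namespace GeneratorsCensus

open Rank3KernelRankCensusN9365 (rows mem_rank3Table rank_eq_three)

/-- **CENSUS WITH THE TAIL, chunk 15** (kernel-computed from the statements of `generators15` — list
`U`, `328` entries — and of `PSatCensusS10CPS.generators15` — list `V`, the `24` tail rows at
positions 27, 30, 37, 40, 68, 80, 109, 157, 158, 163, 183, 194, 262, 263, 285, 303, 304, 308, 309,
311, 330, 337, 342, 346; nothing restated): `352` rows, and NO position remains uncovered. [cite:
CremonaPrickettSiksek2006, Thm 1] [cite: CremonaAlgorithms1997, Tables] -/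
theorem censusT15 : ∃ U V : List (ℕ × ℕ),
    (∀ e ∈ U, ∃ r, rank3Rows15[e.1]? = some r ∧ ∀ (hr : r ∈ rows) (h : r.check = true),
        (AddSubgroup.closure {r.gen₁ h, r.gen₂ h, r.gen₃ h} ⊔ AddCommGroup.torsion _).index ≤ e.2 →
          AddSubgroup.closure {r.gen₁ h, r.gen₂ h, r.gen₃ h} ⊔ AddCommGroup.torsion _ = ⊤) ∧
    (∀ e ∈ V, ∃ r, rank3Rows15[e.1]? = some r ∧ ∀ (hr : r ∈ rows) (h : r.check = true),
        (AddSubgroup.closure {r.gen₁ h, r.gen₂ h, r.gen₃ h} ⊔ AddCommGroup.torsion _).index ≤ e.2 →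
          AddSubgroup.closure {r.gen₁ h, r.gen₂ h, r.gen₃ h} ⊔ AddCommGroup.torsion _ = ⊤) ∧
      U.length = 328 ∧ V.length = 24 ∧ rank3Rows15.length = 352 ∧
      (List.range 352).filter (· ∉ (U ++ V).map Prod.fst) = [] :=
  ⟨_, _, generators15, PSatCensusS10CPS.generators15, by decide +kernel⟩

/-- **CENSUS WITH THE TAIL, chunk 16** (kernel-computed from the statements of `generators16` — list
`U`, `341` entries — and of `PSatCensusS10CPS.generators16` — list `V`, the `11` tail rows at
positions 4, 13, 14, 68, 72, 89, 112, 113, 121, 134, 314; nothing restated): `352` rows, and NO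
position remains uncovered. [cite: CremonaPrickettSiksek2006, Thm 1] [cite: CremonaAlgorithms1997,
Tables] -/
theorem censusT16 : ∃ U V : List (ℕ × ℕ),
    (∀ e ∈ U, ∃ r, rank3Rows16[e.1]? = some r ∧ ∀ (hr : r ∈ rows) (h : r.check = true),
        (AddSubgroup.closure {r.gen₁ h, r.gen₂ h, r.gen₃ h} ⊔ AddCommGroup.torsion _).index ≤ e.2 →
          AddSubgroup.closure {r.gen₁ h, r.gen₂ h, r.gen₃ h} ⊔ AddCommGroup.torsion _ = ⊤) ∧
    (∀ e ∈ V, ∃ r, rank3Rows16[e.1]? = some r ∧ ∀ (hr : r ∈ rows) (h : r.check = true),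
        (AddSubgroup.closure {r.gen₁ h, r.gen₂ h, r.gen₃ h} ⊔ AddCommGroup.torsion _).index ≤ e.2 →
          AddSubgroup.closure {r.gen₁ h, r.gen₂ h, r.gen₃ h} ⊔ AddCommGroup.torsion _ = ⊤) ∧
      U.length = 341 ∧ V.length = 11 ∧ rank3Rows16.length = 352 ∧
      (List.range 352).filter (· ∉ (U ++ V).map Prod.fst) = [] :=
  ⟨_, _, generators16, PSatCensusS10CPS.generators16, by decide +kernel⟩

/-- **CENSUS WITH THE TAIL, chunk 17** (kernel-computed from the statements of `generators17` — list
`U`, `339` entries — and of `PSatCensusS10CPS.generators17` — list `V`, the `13` tail rows at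
positions 3, 64, 75, 84, 86, 90, 118, 152, 157, 171, 180, 182, 280; nothing restated): `352` rows,
and NO position remains uncovered. [cite: CremonaPrickettSiksek2006, Thm 1] [cite:
CremonaAlgorithms1997, Tables] -/
theorem censusT17 : ∃ U V : List (ℕ × ℕ),
    (∀ e ∈ U, ∃ r, rank3Rows17[e.1]? = some r ∧ ∀ (hr : r ∈ rows) (h : r.check = true),
        (AddSubgroup.closure {r.gen₁ h, r.gen₂ h, r.gen₃ h} ⊔ AddCommGroup.torsion _).index ≤ e.2 →
          AddSubgroup.closure {r.gen₁ h, r.gen₂ h, r.gen₃ h} ⊔ AddCommGroup.torsion _ = ⊤) ∧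
    (∀ e ∈ V, ∃ r, rank3Rows17[e.1]? = some r ∧ ∀ (hr : r ∈ rows) (h : r.check = true),
        (AddSubgroup.closure {r.gen₁ h, r.gen₂ h, r.gen₃ h} ⊔ AddCommGroup.torsion _).index ≤ e.2 →
          AddSubgroup.closure {r.gen₁ h, r.gen₂ h, r.gen₃ h} ⊔ AddCommGroup.torsion _ = ⊤) ∧
      U.length = 339 ∧ V.length = 13 ∧ rank3Rows17.length = 352 ∧
      (List.range 352).filter (· ∉ (U ++ V).map Prod.fst) = [] :=
  ⟨_, _, generators17, PSatCensusS10CPS.generators17, by decide +kernel⟩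

/-- **CENSUS WITH THE TAIL, chunk 18** (kernel-computed from the statements of `generators18` — list
`U`, `333` entries — and of `PSatCensusS10CPS.generators18` — list `V`, the `19` tail rows at
positions 0, 4, 8, 17, 25, 38, 44, 51, 61, 153, 154, 160, 177, 243, 263, 264, 273, 332, 346; nothing
restated): `352` rows, and NO position remains uncovered. [cite: CremonaPrickettSiksek2006, Thm 1]
[cite: CremonaAlgorithms1997, Tables] -/
theorem censusT18 : ∃ U V : List (ℕ × ℕ),
    (∀ e ∈ U, ∃ r, rank3Rows18[e.1]? = some r ∧ ∀ (hr : r ∈ rows) (h : r.check = true),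
        (AddSubgroup.closure {r.gen₁ h, r.gen₂ h, r.gen₃ h} ⊔ AddCommGroup.torsion _).index ≤ e.2 →
          AddSubgroup.closure {r.gen₁ h, r.gen₂ h, r.gen₃ h} ⊔ AddCommGroup.torsion _ = ⊤) ∧
    (∀ e ∈ V, ∃ r, rank3Rows18[e.1]? = some r ∧ ∀ (hr : r ∈ rows) (h : r.check = true),
        (AddSubgroup.closure {r.gen₁ h, r.gen₂ h, r.gen₃ h} ⊔ AddCommGroup.torsion _).index ≤ e.2 →
          AddSubgroup.closure {r.gen₁ h, r.gen₂ h, r.gen₃ h} ⊔ AddCommGroup.torsion _ = ⊤) ∧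
      U.length = 333 ∧ V.length = 19 ∧ rank3Rows18.length = 352 ∧
      (List.range 352).filter (· ∉ (U ++ V).map Prod.fst) = [] :=
  ⟨_, _, generators18, PSatCensusS10CPS.generators18, by decide +kernel⟩

/-- **CENSUS WITH THE TAIL, chunk 19** (kernel-computed from the statements of `generators19` — list
`U`, `336` entries — and of `PSatCensusS10CPS.generators19` — list `V`, the `16` tail rows at
positions 21, 27, 28, 61, 68, 82, 86, 138, 160, 178, 209, 210, 260, 273, 318, 347; nothing
restated): `352` rows, and NO position remains uncovered. [cite: CremonaPrickettSiksek2006, Thm 1]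
[cite: CremonaAlgorithms1997, Tables] -/
theorem censusT19 : ∃ U V : List (ℕ × ℕ),
    (∀ e ∈ U, ∃ r, rank3Rows19[e.1]? = some r ∧ ∀ (hr : r ∈ rows) (h : r.check = true),
        (AddSubgroup.closure {r.gen₁ h, r.gen₂ h, r.gen₃ h} ⊔ AddCommGroup.torsion _).index ≤ e.2 →
          AddSubgroup.closure {r.gen₁ h, r.gen₂ h, r.gen₃ h} ⊔ AddCommGroup.torsion _ = ⊤) ∧
    (∀ e ∈ V, ∃ r, rank3Rows19[e.1]? = some r ∧ ∀ (hr : r ∈ rows) (h : r.check = true),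
        (AddSubgroup.closure {r.gen₁ h, r.gen₂ h, r.gen₃ h} ⊔ AddCommGroup.torsion _).index ≤ e.2 →
          AddSubgroup.closure {r.gen₁ h, r.gen₂ h, r.gen₃ h} ⊔ AddCommGroup.torsion _ = ⊤) ∧
      U.length = 336 ∧ V.length = 16 ∧ rank3Rows19.length = 352 ∧
      (List.range 352).filter (· ∉ (U ++ V).map Prod.fst) = [] :=
  ⟨_, _, generators19, PSatCensusS10CPS.generators19, by decide +kernel⟩

/-- **CENSUS WITH THE TAIL, chunk 20** (kernel-computed from the statements of `generators20` — list
`U`, `333` entries — and of `PSatCensusS10CPS.generators20` — list `V`, the `19` tail rows at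
positions 22, 23, 37, 69, 77, 82, 110, 165, 204, 251, 271, 276, 291, 292, 299, 320, 331, 336, 350;
nothing restated): `352` rows, and NO position remains uncovered. [cite: CremonaPrickettSiksek2006,
Thm 1] [cite: CremonaAlgorithms1997, Tables] -/
theorem censusT20 : ∃ U V : List (ℕ × ℕ),
    (∀ e ∈ U, ∃ r, rank3Rows20[e.1]? = some r ∧ ∀ (hr : r ∈ rows) (h : r.check = true),
        (AddSubgroup.closure {r.gen₁ h, r.gen₂ h, r.gen₃ h} ⊔ AddCommGroup.torsion _).index ≤ e.2 →
          AddSubgroup.closure {r.gen₁ h, r.gen₂ h, r.gen₃ h} ⊔ AddCommGroup.torsion _ = ⊤) ∧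
    (∀ e ∈ V, ∃ r, rank3Rows20[e.1]? = some r ∧ ∀ (hr : r ∈ rows) (h : r.check = true),
        (AddSubgroup.closure {r.gen₁ h, r.gen₂ h, r.gen₃ h} ⊔ AddCommGroup.torsion _).index ≤ e.2 →
          AddSubgroup.closure {r.gen₁ h, r.gen₂ h, r.gen₃ h} ⊔ AddCommGroup.torsion _ = ⊤) ∧
      U.length = 333 ∧ V.length = 19 ∧ rank3Rows20.length = 352 ∧
      (List.range 352).filter (· ∉ (U ++ V).map Prod.fst) = [] :=
  ⟨_, _, generators20, PSatCensusS10CPS.generators20, by decide +kernel⟩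

/-- **CENSUS WITH THE TAIL, chunk 21** (kernel-computed from the statements of `generators21` — list
`U`, `343` entries — and of `PSatCensusS10CPS.generators21` — list `V`, the `9` tail rows at
positions 39, 49, 51, 52, 79, 128, 295, 321, 329; nothing restated): `352` rows, and NO position
remains uncovered. [cite: CremonaPrickettSiksek2006, Thm 1] [cite: CremonaAlgorithms1997, Tables] -/
theorem censusT21 : ∃ U V : List (ℕ × ℕ),
    (∀ e ∈ U, ∃ r, rank3Rows21[e.1]? = some r ∧ ∀ (hr : r ∈ rows) (h : r.check = true),
        (AddSubgroup.closure {r.gen₁ h, r.gen₂ h, r.gen₃ h} ⊔ AddCommGroup.torsion _).index ≤ e.2 →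
          AddSubgroup.closure {r.gen₁ h, r.gen₂ h, r.gen₃ h} ⊔ AddCommGroup.torsion _ = ⊤) ∧
    (∀ e ∈ V, ∃ r, rank3Rows21[e.1]? = some r ∧ ∀ (hr : r ∈ rows) (h : r.check = true),
        (AddSubgroup.closure {r.gen₁ h, r.gen₂ h, r.gen₃ h} ⊔ AddCommGroup.torsion _).index ≤ e.2 →
          AddSubgroup.closure {r.gen₁ h, r.gen₂ h, r.gen₃ h} ⊔ AddCommGroup.torsion _ = ⊤) ∧
      U.length = 343 ∧ V.length = 9 ∧ rank3Rows21.length = 352 ∧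
      (List.range 352).filter (· ∉ (U ++ V).map Prod.fst) = [] :=
  ⟨_, _, generators21, PSatCensusS10CPS.generators21, by decide +kernel⟩

/-- **CENSUS WITH THE TAIL, chunk 22** (kernel-computed from the statements of `generators22` — list
`U`, `323` entries — and of `PSatCensusS10CPS.generators22` — list `V`, the `29` tail rows at
positions 1, 19, 26, 32, 40, 59, 100, 102, 104, 107, 114, 115, 117, 125, 139, 149, 152, 169, 189,
212, 240, 243, 256, 263, 302, 303, 313, 314, 334; nothing restated): `352` rows, and NO position
remains uncovered. [cite: CremonaPrickettSiksek2006, Thm 1] [cite: CremonaAlgorithms1997, Tables] -/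
theorem censusT22 : ∃ U V : List (ℕ × ℕ),
    (∀ e ∈ U, ∃ r, rank3Rows22[e.1]? = some r ∧ ∀ (hr : r ∈ rows) (h : r.check = true),
        (AddSubgroup.closure {r.gen₁ h, r.gen₂ h, r.gen₃ h} ⊔ AddCommGroup.torsion _).index ≤ e.2 →
          AddSubgroup.closure {r.gen₁ h, r.gen₂ h, r.gen₃ h} ⊔ AddCommGroup.torsion _ = ⊤) ∧
    (∀ e ∈ V, ∃ r, rank3Rows22[e.1]? = some r ∧ ∀ (hr : r ∈ rows) (h : r.check = true),
        (AddSubgroup.closure {r.gen₁ h, r.gen₂ h, r.gen₃ h} ⊔ AddCommGroup.torsion _).index ≤ e.2 →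
          AddSubgroup.closure {r.gen₁ h, r.gen₂ h, r.gen₃ h} ⊔ AddCommGroup.torsion _ = ⊤) ∧
      U.length = 323 ∧ V.length = 29 ∧ rank3Rows22.length = 352 ∧
      (List.range 352).filter (· ∉ (U ++ V).map Prod.fst) = [] :=
  ⟨_, _, generators22, PSatCensusS10CPS.generators22, by decide +kernel⟩

/-- **CENSUS WITH THE TAIL, chunk 23** (kernel-computed from the statements of `generators23` — list
`U`, `324` entries — and of `PSatCensusS10CPS.generators23` — list `V`, the `28` tail rows at
positions 11, 24, 30, 36, 43, 70, 71, 100, 126, 128, 135, 157, 168, 201, 202, 209, 210, 229, 256,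
257, 284, 291, 296, 314, 320, 329, 346, 347; nothing restated): `352` rows, and NO position remains
uncovered. [cite: CremonaPrickettSiksek2006, Thm 1] [cite: CremonaAlgorithms1997, Tables] -/
theorem censusT23 : ∃ U V : List (ℕ × ℕ),
    (∀ e ∈ U, ∃ r, rank3Rows23[e.1]? = some r ∧ ∀ (hr : r ∈ rows) (h : r.check = true),
        (AddSubgroup.closure {r.gen₁ h, r.gen₂ h, r.gen₃ h} ⊔ AddCommGroup.torsion _).index ≤ e.2 →
          AddSubgroup.closure {r.gen₁ h, r.gen₂ h, r.gen₃ h} ⊔ AddCommGroup.torsion _ = ⊤) ∧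
    (∀ e ∈ V, ∃ r, rank3Rows23[e.1]? = some r ∧ ∀ (hr : r ∈ rows) (h : r.check = true),
        (AddSubgroup.closure {r.gen₁ h, r.gen₂ h, r.gen₃ h} ⊔ AddCommGroup.torsion _).index ≤ e.2 →
          AddSubgroup.closure {r.gen₁ h, r.gen₂ h, r.gen₃ h} ⊔ AddCommGroup.torsion _ = ⊤) ∧
      U.length = 324 ∧ V.length = 28 ∧ rank3Rows23.length = 352 ∧
      (List.range 352).filter (· ∉ (U ++ V).map Prod.fst) = [] :=
  ⟨_, _, generators23, PSatCensusS10CPS.generators23, by decide +kernel⟩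

/-- **CENSUS WITH THE TAIL, chunk 24** (kernel-computed from the statements of `generators24` — list
`U`, `329` entries — and of `PSatCensusS10CPS.generators24` — list `V`, the `23` tail rows at
positions 6, 9, 29, 38, 55, 61, 74, 81, 121, 132, 154, 189, 214, 223, 228, 230, 299, 318, 320, 331,
334, 338, 340; nothing restated): `352` rows, and NO position remains uncovered. [cite:
CremonaPrickettSiksek2006, Thm 1] [cite: CremonaAlgorithms1997, Tables] -/
theorem censusT24 : ∃ U V : List (ℕ × ℕ),
    (∀ e ∈ U, ∃ r, rank3Rows24[e.1]? = some r ∧ ∀ (hr : r ∈ rows) (h : r.check = true),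
        (AddSubgroup.closure {r.gen₁ h, r.gen₂ h, r.gen₃ h} ⊔ AddCommGroup.torsion _).index ≤ e.2 →
          AddSubgroup.closure {r.gen₁ h, r.gen₂ h, r.gen₃ h} ⊔ AddCommGroup.torsion _ = ⊤) ∧
    (∀ e ∈ V, ∃ r, rank3Rows24[e.1]? = some r ∧ ∀ (hr : r ∈ rows) (h : r.check = true),
        (AddSubgroup.closure {r.gen₁ h, r.gen₂ h, r.gen₃ h} ⊔ AddCommGroup.torsion _).index ≤ e.2 →
          AddSubgroup.closure {r.gen₁ h, r.gen₂ h, r.gen₃ h} ⊔ AddCommGroup.torsion _ = ⊤) ∧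
      U.length = 329 ∧ V.length = 23 ∧ rank3Rows24.length = 352 ∧
      (List.range 352).filter (· ∉ (U ++ V).map Prod.fst) = [] :=
  ⟨_, _, generators24, PSatCensusS10CPS.generators24, by decide +kernel⟩

/-- **CENSUS WITH THE TAIL, chunk 25** (kernel-computed from the statements of `generators25` — list
`U`, `329` entries — and of `PSatCensusS10CPS.generators25` — list `V`, the `23` tail rows at
positions 24, 30, 40, 59, 70, 71, 81, 85, 86, 94, 123, 143, 146, 163, 202, 206, 216, 234, 262, 279,
286, 308, 340; nothing restated): `352` rows, and NO position remains uncovered. [cite: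
CremonaPrickettSiksek2006, Thm 1] [cite: CremonaAlgorithms1997, Tables] -/
theorem censusT25 : ∃ U V : List (ℕ × ℕ),
    (∀ e ∈ U, ∃ r, rank3Rows25[e.1]? = some r ∧ ∀ (hr : r ∈ rows) (h : r.check = true),
        (AddSubgroup.closure {r.gen₁ h, r.gen₂ h, r.gen₃ h} ⊔ AddCommGroup.torsion _).index ≤ e.2 →
          AddSubgroup.closure {r.gen₁ h, r.gen₂ h, r.gen₃ h} ⊔ AddCommGroup.torsion _ = ⊤) ∧
    (∀ e ∈ V, ∃ r, rank3Rows25[e.1]? = some r ∧ ∀ (hr : r ∈ rows) (h : r.check = true),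
        (AddSubgroup.closure {r.gen₁ h, r.gen₂ h, r.gen₃ h} ⊔ AddCommGroup.torsion _).index ≤ e.2 →
          AddSubgroup.closure {r.gen₁ h, r.gen₂ h, r.gen₃ h} ⊔ AddCommGroup.torsion _ = ⊤) ∧
      U.length = 329 ∧ V.length = 23 ∧ rank3Rows25.length = 352 ∧
      (List.range 352).filter (· ∉ (U ++ V).map Prod.fst) = [] :=
  ⟨_, _, generators25, PSatCensusS10CPS.generators25, by decide +kernel⟩

/-- **CENSUS WITH THE TAIL, chunk 26** (kernel-computed from the statements of `generators26` — list
`U`, `328` entries — and of `PSatCensusS10CPS.generators26` — list `V`, the `24` tail rows at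
positions 6, 22, 23, 60, 84, 97, 98, 116, 117, 156, 157, 161, 167, 168, 182, 186, 195, 203, 252,
266, 303, 318, 330, 340; nothing restated): `352` rows, and NO position remains uncovered. [cite:
CremonaPrickettSiksek2006, Thm 1] [cite: CremonaAlgorithms1997, Tables] -/
theorem censusT26 : ∃ U V : List (ℕ × ℕ),
    (∀ e ∈ U, ∃ r, rank3Rows26[e.1]? = some r ∧ ∀ (hr : r ∈ rows) (h : r.check = true),
        (AddSubgroup.closure {r.gen₁ h, r.gen₂ h, r.gen₃ h} ⊔ AddCommGroup.torsion _).index ≤ e.2 →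
          AddSubgroup.closure {r.gen₁ h, r.gen₂ h, r.gen₃ h} ⊔ AddCommGroup.torsion _ = ⊤) ∧
    (∀ e ∈ V, ∃ r, rank3Rows26[e.1]? = some r ∧ ∀ (hr : r ∈ rows) (h : r.check = true),
        (AddSubgroup.closure {r.gen₁ h, r.gen₂ h, r.gen₃ h} ⊔ AddCommGroup.torsion _).index ≤ e.2 →
          AddSubgroup.closure {r.gen₁ h, r.gen₂ h, r.gen₃ h} ⊔ AddCommGroup.torsion _ = ⊤) ∧
      U.length = 328 ∧ V.length = 24 ∧ rank3Rows26.length = 352 ∧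
      (List.range 352).filter (· ∉ (U ++ V).map Prod.fst) = [] :=
  ⟨_, _, generators26, PSatCensusS10CPS.generators26, by decide +kernel⟩

/-- **CENSUS WITH THE TAIL, chunk 27** (kernel-computed from the statements of `generators27` — list
`U`, `317` entries — and of `PSatCensusS10CPS.generators27` — list `V`, the `18` tail rows at
positions 9, 16, 25, 26, 54, 58, 70, 89, 96, 105, 140, 150, 171, 182, 183, 251, 263, 287; nothing
restated): `335` rows, and NO position remains uncovered. [cite: CremonaPrickettSiksek2006, Thm 1]
[cite: CremonaAlgorithms1997, Tables] -/
theorem censusT27 : ∃ U V : List (ℕ × ℕ),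
    (∀ e ∈ U, ∃ r, rank3Rows27[e.1]? = some r ∧ ∀ (hr : r ∈ rows) (h : r.check = true),
        (AddSubgroup.closure {r.gen₁ h, r.gen₂ h, r.gen₃ h} ⊔ AddCommGroup.torsion _).index ≤ e.2 →
          AddSubgroup.closure {r.gen₁ h, r.gen₂ h, r.gen₃ h} ⊔ AddCommGroup.torsion _ = ⊤) ∧
    (∀ e ∈ V, ∃ r, rank3Rows27[e.1]? = some r ∧ ∀ (hr : r ∈ rows) (h : r.check = true),
        (AddSubgroup.closure {r.gen₁ h, r.gen₂ h, r.gen₃ h} ⊔ AddCommGroup.torsion _).index ≤ e.2 →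
          AddSubgroup.closure {r.gen₁ h, r.gen₂ h, r.gen₃ h} ⊔ AddCommGroup.torsion _ = ⊤) ∧
      U.length = 317 ∧ V.length = 18 ∧ rank3Rows27.length = 335 ∧
      (List.range 335).filter (· ∉ (U ++ V).map Prod.fst) = [] :=
  ⟨_, _, generators27, PSatCensusS10CPS.generators27, by decide +kernel⟩

/-- **CENSUS TOTAL WITH THE TAIL** (arithmetic of the kernel-computed chunk counts, in chunk order:
covered by the census of record `censusNN`, plus the tail rows of `censusTNN`): `9487` of the `9487`
rank-3 table rows have a generators theorem under ONE named numeric index hypothesis; residual `0`.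
[cite: CremonaPrickettSiksek2006, Thm 1] [cite: CremonaAlgorithms1997, Tables] -/
theorem census_total_tail :
    ([350, 347, 348, 344, 343, 341, 337, 340, 344, 340, 332, 339, 340, 343, 328, 341, 339, 333, 336,
      333, 343, 323, 324, 329, 329, 328, 317] : List ℕ).sum = 9091 ∧
    ([2, 5, 4, 8, 9, 11, 15, 12, 8, 12, 20, 13, 12, 9, 24, 11, 13, 19, 16, 19, 9, 29, 28, 23, 23,
      24, 18] : List ℕ).sum = 396 ∧
    9091 + 396 = 9487 ∧ 9487 - 9487 = 0 := by
  decide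

end GeneratorsCensus

end Summit.BirchSwinnertonDyer.BirchSwinnertonDyer.Rank2Observatory
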